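import Summits.KontsevichZagierPeriods.KontsevichZagierPeriods.Theses.PeriodConductors
import Summits.KontsevichZagierPeriods.KontsevichZagierPeriods.Theorems.LinRedNormalFormMzvKernelInKZScoping

/-!
# Crux `UnimodularKernel` (stmt-KontsevichZagierPeriods-8404) — line `graphic-core` (strategist s2, ALTERNATIVE to `Lines/birth.lean`)

Route `PeriodConductors`, rank-3 crux `UnimodularKernel` = "Conjecture 1 over Spec ℤ" on the
everywhere-good (regular-matroid) linear sector.

THE RE-CUT. The live line `birth` carries the whole crux-specific content in ONE stub
(`stub_regularCellNormalForm`: every regular cell ≡ MZV words, "extending `DihedralNormalForm` from the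
braid cells to all regular cells" — i.e. it contains the sibling crux `LinRedNormalForm.DihedralNormalForm`
AND asks for its unfolded-hyperlogarithm engine to be rebuilt on general regular cells). This line moves
the GEOMETRY instead of the ANALYSIS:

  regular cell ─(stub 1, matroid structure)→ ℤ-combination of ℚ-PROJECTIVELY-BRAID cells
               ─(stub 2, projective moves + chamber dissection; provable now)→ ℤ-combination of DIHEDRAL reps
               ─(stub 3 = `DihedralNormalForm` BY NAME)→ ℤ-combination of MZV word reps
               ─(soundness + stubs 4 ∧ 5 = `HoffmanSpanInKZ` ∧ `HoffmanIndependence` BY NAME)→ kernel.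

Why stub 1 is the right residue (matroid facts, all classical): "good at every prime" forces the row
matroid of `M` (hyperplane at infinity included) to be representable over `𝔽₂` and `𝔽₃`, hence REGULAR
(Tutte), and `M` itself to be `GL_{n+1}(ℤ)`-equivalent to a totally unimodular matrix (basis minors `±1`).
Regular matroids are uniquely representable (Brylawski–Lucas: binary ⇒ projectively unique), so a
GRAPHIC everywhere-good configuration is `GL_{n+1}(ℚ)`-projectively a sub-configuration of the braid
arrangement `A_{n+1}` = `M(K_{n+2})` (rows `1, xᵢ, 1 − xᵢ, xᵢ − xⱼ` up to sign, the distinguished edge =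
the hyperplane at infinity): for these stub 1 is LINEAR ALGEBRA (no moves beyond bookkeeping). By
Tutte's excluded minors (`M*(K₅)`, `M*(K₃,₃)`) and Heller's bound, every regular matroid of rank ≤ 3 is
graphic and the ONLY simple non-graphic regular matroid of rank 4 is the cographic `M*(K₃,₃)`; in
general Seymour's decomposition (1-, 2-, 3-sums of graphic, cographic, `R₁₀`) localises the open content
of stub 1 to: cographic blocks, `R₁₀` blocks, and 3-sum gluing (1- and 2-sums are products = Fubini, and
shuffles of braid cells are braid cells). So relative to `birth`, stub 1 is WEAKER than
`stub_regularCellNormalForm` outright (MZV word reps ARE projectively-braid cells: `B` = braid rows,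
`g = 1`), nothing analytic is re-done (stub 3 imports the sibling programme by name), and the new
mathematics is named: the first cell of the crux outside the dihedral sector is a chamber of ONE
arrangement in `ℝ³`, `{x, y, z, 1−x−y−z, 1−y−z, y+z, 1−x−z, x+z}` + ∞ (cycle matrix of `K₃,₃`), whose
tetrahedron cells engaging all nine planes (4 walls, 4 poles, ∞ a pole: numerator of degree ≥ 1) are the
first genuinely non-dihedral regular cells; censused numerically by kit j025578/j025619 (value shadow:
`ℚ + ℚζ(2) + ℚζ(3)`, see `Lines/graphic_core.md`).

Stubs (the only `sorry`s of this file):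
* `stub_regularToProjBraid` (THE CORE; open in general, linear algebra on the graphic sub-sector):
  every everywhere-good linear-cell representation is ≡ mod `KZ.relations` to a `ℤ`-combination of
  representations over cells whose matrix is `B·g`, `B` with rows in the signed braid list, `g ∈ GL_{n+1}(ℚ)`,
  one row of `B·g` the hyperplane at infinity.
* `stub_projBraidToDihedral` (provable now, size L): such a cell is ≡ to a `ℤ`-combination of DIHEDRAL
  representations (standard open simplex, integrand `P/∏tᵢ^{bᵢ}∏(1−tᵢ)^{cᵢ}∏_{i<j}(tᵢ−tⱼ)^{aᵢⱼ}` — verbatim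
  the hypothesis class of `DihedralNormalForm`): cut by the preimage of the braid infinity (rule 1a, null
  wall; it IS one of the cell's hyperplanes since `e₀` is a row of `B·g`), map each half by the projective
  transformation `x ↦ (gX)'/(gX)₀` (rule 2: semialgebraic, injective, Jacobian `|det g|/|μ(y)|^{n+1}` with
  `μ` a braid form), dissect the image (a cell of a braid sub-arrangement) into chambers of the full affine
  braid arrangement (rule 1a), and move each chamber to the standard simplex by an `S_{n+2}` permutation of
  the homogeneous coordinates (rule 2 again; numerator and Jacobian denominators are braid forms, so the
  dihedral shape is preserved; absolute convergence of the pieces is inherited from the cell).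
* `stub_dihedralNormalForm` = `LinRedNormalForm.DihedralNormalForm` (stmt-3912) BY NAME.
* `stub_hoffmanSpanInKZ` = `LinRedNormalForm.HoffmanSpanInKZ` (stmt-15044) BY NAME.
* `stub_hoffmanIndependence` = `LinRedNormalForm.HoffmanIndependence` (stmt-15045) BY NAME (declared
  transcendence input; not attacked).

Composition (`unimodularKernel_of_stubs`, sorry-free): three hops of
`LinRedNormalForm.MzvKernelInKZ.exists_congr_of_mem_closure` give birth's hypothesis `hA` (regular cell ≡
MZV words), then soundness (`KZ.relations_le_ker_eval_holds`) and the landed scoping theorem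
`mzvKernelInKZ_of_hoffmanSpanInKZ`. `UnimodularKernel_of : UnimodularKernel` concludes the crux BY NAME via
the `Iff.rfl` read-back `unimodularKernel_iff`.

Disproof used: no `Disproof.lean` exists for stmt-8404 (`ledger crux ls`); negatives index of the summit:
1 entry (KinematicPlaneConvex), unrelated; `Theorems/HoffmanIndependence/Negative/*` refute only
strengthenings of stub 5, used verbatim. Barriers: as `birth` (strength barriers confined to stub 5;
`noSemialgebraicPrimitive_inv_sub_two` not engaged by stubs 1–2 at all — they integrate nothing out:
only rules 1a and 2 and linear algebra; `cressonViuSos_prop_3_2` not engaged — the projective maps act on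
cells of the SAME arrangement, no scissors congruence between unrelated bodies is claimed).
-/

noncomputable section

set_option linter.dupNamespace false

open Literature.NumberTheory.Transcendental
open Summit.KontsevichZagierPeriods.KontsevichZagierPeriods.Theses.PeriodConductors (UnimodularKernel)
open Summit.KontsevichZagierPeriods.KontsevichZagierPeriods.Theses.LinRedNormalForm
  (DihedralNormalForm MzvKernelInKZ HoffmanSpanInKZ HoffmanIndependence)
open Summit.KontsevichZagierPeriods.LinRedNormalForm.MzvKernelInKZ
  (exists_congr_of_mem_closure mzvKernelInKZ_of_hoffmanSpanInKZ)

namespace Summit.KontsevichZagierPeriods.KontsevichZagierPeriods.Cruxes.UnimodularKernel.GraphicCore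

/-! ### Vocabulary (the crux's `let` bodies verbatim, read back by `Iff.rfl`; plus the two intermediate sectors) -/

/-- The integral affine form of row `i` of `M` (column `0` = constant term = hyperplane at infinity). [folklore] -/
def lin (n k : ℕ) (M : Fin k → Fin (n + 1) → ℤ) (i : Fin k) (x : Fin n → ℝ) : ℝ :=
  (M i 0 : ℝ) + ∑ j : Fin n, (M i j.succ : ℝ) * x j

/-- The same affine form for a RATIONAL matrix (the projectively-braid sector has matrices `B·g`,
`g ∈ GL_{n+1}(ℚ)`). [folklore] -/
def linQ (n k : ℕ) (N : Fin k → Fin (n + 1) → ℚ) (i : Fin k) (x : Fin n → ℝ) : ℝ :=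
  (N i 0 : ℝ) + ∑ j : Fin n, (N i j.succ : ℝ) * x j

/-- Good reduction of the row matroid of `M` at `p` (the crux's `good n k p M`, definitionally). [folklore] -/
def regularAt (n k p : ℕ) : Set (Fin k → Fin (n + 1) → ℤ) :=
  {M | ∀ T : Finset (Fin k),
    (Matrix.of fun (i : T) (j : Fin (n + 1)) => (M i j : ZMod p)).rank =
      (Matrix.of fun (i : T) (j : Fin (n + 1)) => (M i j : ℚ)).rank}

/-- The crux's generators with bad reduction inside `S` (verbatim the crux's `cell`). [folklore] -/
def cell (S : Finset ℕ) : Set KZ.FormalRep :=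
  {x | ∃ (n k : ℕ) (M : Fin k → Fin (n + 1) → ℤ) (w : Fin k → Bool) (m : Fin k → ℕ)
      (P : MvPolynomial (Fin n) ℚ) (r : KZ.IntegralRep n),
    (∃ i, M i = Pi.single 0 1) ∧ (∀ p : ℕ, p.Prime → p ∉ S → M ∈ regularAt n k p) ∧
    r.domain = {x | ∀ i, w i = true → 0 < lin n k M i x} ∧
    Set.EqOn r.integrand (fun x => MvPolynomial.aeval x P / ∏ i, lin n k M i x ^ m i) r.domain ∧
    x = KZ.of r}

/-- The SIGNED BRAID ROWS in homogeneous coordinates `(X₀ : … : Xₙ)`, `xᵢ = Xᵢ/X₀`: `±1` (infinity),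
`±xᵢ`, `±(1 − xᵢ)`, `±(xᵢ − xⱼ)` — the graphic configuration `M(K_{n+2})` = braid arrangement `A_{n+1}`.
[folklore; Orlik–Terao, Arrangements of Hyperplanes, Ex. 1.10] -/
def braidRows (n : ℕ) : Set (Fin (n + 1) → ℤ) :=
  {v | ∃ s : ℤ, (s = 1 ∨ s = -1) ∧
    (v = Pi.single 0 s ∨ (∃ i : Fin n, v = Pi.single i.succ s) ∨
     (∃ i : Fin n, v = Pi.single 0 s - Pi.single i.succ s) ∨
     (∃ i j : Fin n, i ≠ j ∧ v = Pi.single i.succ s - Pi.single j.succ s))}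

/-- The ℚ-PROJECTIVELY-BRAID sector: representations over an open cell `{ℓᵢ > 0}` with integrand
`P/∏ℓᵢ^{mᵢ}` whose matrix of affine forms is `B·g` with `B` braid rows (signed) and `g ∈ GL_{n+1}(ℚ)`,
and where the hyperplane at infinity is EITHER itself one of these forms (`e₀` a row of `B·g`) OR not a
pole of the form `P dx/∏ℓᵢ^{mᵢ}` (its order there is `deg P + n + 1 − Σ mᵢ ≤ 0`): exactly the condition
under which the projective map `x ↦ (gX)'/(gX)₀` lands on a braid-type integrand (the image `μ` of
infinity enters with exponent `−(deg P + n + 1 − Σ mᵢ)`). "Engaged configuration" = walls ∪ poles ∪ {∞ if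
it is a pole}; unique representability of regular matroids puts every cell whose engaged configuration is
GRAPHIC here with no move at all. [Brylawski–Lucas 1976 (unique representability of binary matroids);
Oxley, Matroid Theory, §6.6, §10.1] -/
def projBraidCell : Set KZ.FormalRep :=
  {x | ∃ (n k : ℕ) (B : Fin k → Fin (n + 1) → ℤ) (g : Matrix (Fin (n + 1)) (Fin (n + 1)) ℚ)
      (w : Fin k → Bool) (m : Fin k → ℕ) (P : MvPolynomial (Fin n) ℚ) (r : KZ.IntegralRep n),
    (∀ i, B i ∈ braidRows n) ∧ IsUnit g ∧
    ((∃ i, (fun i j => ∑ l, (B i l : ℚ) * g l j) i = Pi.single 0 1) ∨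
      P.totalDegree + n + 1 ≤ ∑ i, m i) ∧
    r.domain = {x | ∀ i, w i = true → 0 < linQ n k (fun i j => ∑ l, (B i l : ℚ) * g l j) i x} ∧
    Set.EqOn r.integrand (fun x => MvPolynomial.aeval x P /
      ∏ i, linQ n k (fun i j => ∑ l, (B i l : ℚ) * g l j) i x ^ m i) r.domain ∧
    x = KZ.of r}

/-- The DIHEDRAL (genus-zero) generators: verbatim the hypothesis class of
`LinRedNormalForm.DihedralNormalForm` / the generator set of `LinRedNormalForm.ResidualBeyondGenusZero`
(open ordered simplex, integrand `P/∏tᵢ^{bᵢ}∏(1−tᵢ)^{cᵢ}∏_{i<j}(tᵢ−tⱼ)^{aᵢⱼ}`). [BrownENS2009 §1] -/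
def dihedralGen : Set KZ.FormalRep :=
  {x | ∃ (k : ℕ) (r : KZ.IntegralRep k) (p : MvPolynomial (Fin k) ℚ) (a : Fin k → Fin k → ℕ)
      (b c : Fin k → ℕ),
    r.domain = {t | (∀ i, 0 < t i) ∧ (∀ i, t i < 1) ∧ StrictAnti t} ∧
    Set.EqOn r.integrand (fun t => MvPolynomial.aeval t p /
      ((∏ i, t i ^ b i) * (∏ i, (1 - t i) ^ c i) * ∏ i, ∏ j, if i < j then (t i - t j) ^ a i j else 1))
      r.domain ∧
    x = KZ.of r}

/-- The MZV WORD generators `[Δ_w, q·∏ω_ε]` — verbatim the generator set of `LinRedNormalForm.MzvKernelInKZ`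
and the conclusion class of `DihedralNormalForm`. [folklore] -/
def mzvWordGen : Set KZ.FormalRep :=
  {x | ∃ (w : ℕ) (ε : Fin w → Bool) (q : ℚ) (s : KZ.IntegralRep w),
    s.domain = {t | (∀ i, 0 < t i) ∧ (∀ i, t i < 1) ∧ StrictAnti t} ∧
    Set.EqOn s.integrand (fun t => (q : ℝ) * ∏ i, if ε i then 1 / (1 - t i) else 1 / t i) s.domain ∧
    x = KZ.of s}

/-- Read-back (definitional): the crux is the kernel statement on the subgroup generated by `cell ∅`. [folklore] -/
theorem unimodularKernel_iff :
    UnimodularKernel ↔ ∀ c ∈ AddSubgroup.closure (cell ∅), KZ.eval c = 0 → c ∈ KZ.relations :=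
  Iff.rfl

/-- Read-back (definitional): `MzvKernelInKZ` is the kernel statement on the MZV-word subgroup. [folklore] -/
theorem mzvKernelInKZ_iff :
    MzvKernelInKZ ↔ ∀ c ∈ AddSubgroup.closure mzvWordGen, KZ.eval c = 0 → c ∈ KZ.relations :=
  Iff.rfl

/-- Read-back (definitional): `DihedralNormalForm` says every dihedral generator is ≡ an MZV-word
combination. [folklore] -/
theorem dihedralNormalForm_iff :
    DihedralNormalForm ↔
      ∀ (k : ℕ) (r : KZ.IntegralRep k) (p : MvPolynomial (Fin k) ℚ) (a : Fin k → Fin k → ℕ)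
        (b c : Fin k → ℕ),
        r.domain = {t | (∀ i, 0 < t i) ∧ (∀ i, t i < 1) ∧ StrictAnti t} →
        Set.EqOn r.integrand (fun t => MvPolynomial.aeval t p /
          ((∏ i, t i ^ b i) * (∏ i, (1 - t i) ^ c i) * ∏ i, ∏ j, if i < j then (t i - t j) ^ a i j else 1))
          r.domain →
        ∃ m ∈ AddSubgroup.closure mzvWordGen, KZ.of r - m ∈ KZ.relations :=
  Iff.rfl


/-! ### Registered stubs (the only `sorry`s of this file) -/

/-- **STUB 1 — `regularToProjBraid` (THE CORE of this line; open in general, linear algebra on the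
graphic sub-sector).** Every representation over an open rational linear cell with linear poles whose
integer matrix (hyperplane at infinity included) has good reduction at EVERY prime is congruent modulo
`KZ.relations` to a `ℤ`-combination of representations of the same shape over ℚ-PROJECTIVELY-BRAID cells
(matrix `B·g`, `B` signed braid rows, `g ∈ GL_{n+1}(ℚ)`, `e₀` a row). Mechanism: good at all `p` ⇒ the
row matroid is regular and `M ∼ TU·GL(ℤ)`; graphic blocks are projectively braid by unique
representability (no move needed); 1- and 2-sums are products of lower cells (Fubini = `KZ.of_mul_of`,
shuffles = rule 1a); the OPEN part is the accessibility of cographic (`M*(K₃,₃)`, …), `R₁₀` and 3-sum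
cells — first instance: the chambers of `{x,y,z,1−x−y−z,1−y−z,y+z,1−x−z,x+z}` in `ℝ³`. Why it might fail:
a cographic/`R₁₀` chamber integral with no move chain into braid cells with absolutely convergent
intermediates (value-level it is consistent iff `UnimodularValuesAreMZV`; kit census j025578/j025619).
[Seymour1980 (decomposition of regular matroids); Tutte1959; BrylawskiLucas1976; Heller1957;
arXiv:1410.6348; arXiv:math/0302267; arXiv:1102.1312; KontsevichZagier2001 §1.2] -/
theorem stub_regularToProjBraid :
    ∀ (n k : ℕ) (M : Fin k → Fin (n + 1) → ℤ) (w : Fin k → Bool) (m : Fin k → ℕ)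
      (P : MvPolynomial (Fin n) ℚ) (r : KZ.IntegralRep n),
      (∃ i, M i = Pi.single 0 1) → (∀ p : ℕ, p.Prime → M ∈ regularAt n k p) →
      r.domain = {x | ∀ i, w i = true → 0 < lin n k M i x} →
      Set.EqOn r.integrand (fun x => MvPolynomial.aeval x P / ∏ i, lin n k M i x ^ m i) r.domain →
      ∃ c ∈ AddSubgroup.closure projBraidCell, KZ.of r - c ∈ KZ.relations := by
  sorry

/-- **STUB 2 — `projBraidToDihedral` (provable now; size L).** Every ℚ-projectively-braid cell
representation is congruent modulo `KZ.relations` to a `ℤ`-combination of DIHEDRAL representations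
(standard open simplex, integrand `P/∏tᵢ^{bᵢ}∏(1−tᵢ)^{cᵢ}∏_{i<j}(tᵢ−tⱼ)^{aᵢⱼ}`). Chain: rule 1a along
the (null) hyperplane `(gX)₀ = 0`, rule 2 by the projective map `x ↦ (gX)'/(gX)₀` on each half
(semialgebraic, injective, `C¹`; Jacobian `|det g|·|μ(y)|^{-(n+1)}`, `P ↦ P̃/μ^{deg P}`, `ℓᵢ ↦ bᵢ/μ`, so `μ`
= the image of infinity enters with exponent `Σmᵢ − deg P − n − 1`: in the first case of the sector
condition `μ = Bᵢ₀·(1,y)` is a braid form, in the second the exponent is `≥ 0` and `μ` is a polynomial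
factor — either way the image integrand is braid-type), rule 1a into chambers of the full affine braid
arrangement (finitely many, walls null), rule 2 by the `S_{n+2}` coordinate permutation taking a chamber to
`{1 > t₀ > ⋯ > t_{n−1} > 0}` (braid forms ↦ braid forms over a braid form); absolute convergence of every
piece is inherited (sub-domains, diffeomorphic images). Why it might fail: only Lean cost (projective
change of variables with its Jacobian, chamber bookkeeping over permutations, sign/numerator matching).
[KontsevichZagier2001 §1.2 rules (1a),(2); BrownENS2009 §2 (simplicial coordinates on `M_{0,n}`)] -/
theorem stub_projBraidToDihedral :
    ∀ x ∈ projBraidCell, ∃ c ∈ AddSubgroup.closure dihedralGen, x - c ∈ KZ.relations := by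
  sorry

/-- **STUB 3 — `dihedralNormalForm` = route `LinRedNormalForm` crux `DihedralNormalForm`
(stmt-KontsevichZagierPeriods-3912) BY NAME (the sibling's live programme; open).** [BrownENS2009 Thm 1.1;
Brown2009; Panzer2015] -/
theorem stub_dihedralNormalForm : DihedralNormalForm := by
  sorry

/-- **STUB 4 — `hoffmanSpanInKZ` = `LinRedNormalForm.HoffmanSpanInKZ` (stmt-15044) BY NAME (rules ≡
motives on the MZV sector; open).** [Brown2012 Thm 1.1/7.4; arXiv:1102.1310; HuberMullerStachPeriods2017
Rem 13.1.8] -/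
theorem stub_hoffmanSpanInKZ : HoffmanSpanInKZ := by
  sorry

/-- **STUB 5 — `hoffmanIndependence` = `LinRedNormalForm.HoffmanIndependence` (stmt-15045) BY NAME (the
declared transcendence input; not attacked).** [Zagier1994 §9; Brown2012 Thm 1.1] -/
theorem stub_hoffmanIndependence : HoffmanIndependence := by
  sorry

/-! ### Composition (no `sorry` below this line) -/

/-- **Composition, hypotheses form.** The five stub STATEMENTS imply the kernel statement on the regular
sector: three hops of closure induction (regular → projectively braid → dihedral → MZV words) give
birth's hypothesis `hA`; then soundness and the MZV kernel from stubs 4 ∧ 5 (landed scoping theorem).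
[folklore] -/
theorem unimodularKernel_of_stubs
    (h1 : ∀ (n k : ℕ) (M : Fin k → Fin (n + 1) → ℤ) (w : Fin k → Bool) (m : Fin k → ℕ)
      (P : MvPolynomial (Fin n) ℚ) (r : KZ.IntegralRep n),
      (∃ i, M i = Pi.single 0 1) → (∀ p : ℕ, p.Prime → M ∈ regularAt n k p) →
      r.domain = {x | ∀ i, w i = true → 0 < lin n k M i x} →
      Set.EqOn r.integrand (fun x => MvPolynomial.aeval x P / ∏ i, lin n k M i x ^ m i) r.domain →
      ∃ c ∈ AddSubgroup.closure projBraidCell, KZ.of r - c ∈ KZ.relations)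
    (h2 : ∀ x ∈ projBraidCell, ∃ c ∈ AddSubgroup.closure dihedralGen, x - c ∈ KZ.relations)
    (h3 : DihedralNormalForm) (hB : HoffmanSpanInKZ) (hC : HoffmanIndependence) :
    ∀ c ∈ AddSubgroup.closure (cell ∅), KZ.eval c = 0 → c ∈ KZ.relations := by
  -- the MZV-sector kernel, derived from stubs 4 ∧ 5 (route LinRedNormalForm's scoping, landed)
  have hKER : ∀ c ∈ AddSubgroup.closure mzvWordGen, KZ.eval c = 0 → c ∈ KZ.relations :=
    mzvKernelInKZ_iff.mp (mzvKernelInKZ_of_hoffmanSpanInKZ hB hC)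
  -- stub 3 on generators: dihedral reps to MZV words
  have h3' : ∀ x ∈ dihedralGen, ∃ m ∈ AddSubgroup.closure mzvWordGen, x - m ∈ KZ.relations := by
    rintro x ⟨k, r, p, a, b, c', hd, hi, rfl⟩
    exact (dihedralNormalForm_iff.mp h3) k r p a b c' hd hi
  -- birth's hypothesis hA in three hops
  have hA : ∀ x ∈ cell ∅, ∃ m ∈ AddSubgroup.closure mzvWordGen, x - m ∈ KZ.relations := by
    rintro x ⟨n, k, M, w, mult, P, r, hinf, hgood, hdom, hint, rfl⟩
    obtain ⟨c₁, hc₁, h₁⟩ := h1 n k M w mult P r hinf (fun p hp => hgood p hp (by simp)) hdom hint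
    obtain ⟨c₂, hc₂, h₂⟩ := exists_congr_of_mem_closure (T := dihedralGen) hc₁ h2
    obtain ⟨c₃, hc₃, h₃⟩ := exists_congr_of_mem_closure (T := mzvWordGen) hc₂ h3'
    refine ⟨c₃, hc₃, ?_⟩
    have key := add_mem (add_mem h₁ h₂) h₃
    rwa [show KZ.of r - c₁ + (c₁ - c₂) + (c₂ - c₃) = KZ.of r - c₃ by abel] at key
  intro c hc hc0
  obtain ⟨m, hm, hcm⟩ := exists_congr_of_mem_closure (T := mzvWordGen) hc hA
  -- soundness of the moves: `eval m = eval c = 0`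
  have hm0 : KZ.eval m = 0 := by
    have h := (AddMonoidHom.mem_ker).1 (KZ.relations_le_ker_eval_holds hcm)
    rwa [map_sub, hc0, zero_sub, neg_eq_zero] at h
  have key := add_mem hcm (hKER m hm hm0)
  rwa [sub_add_cancel] at key

/-- **Skeleton theorem (registered form).** The crux `UnimodularKernel` BY NAME from the five declared
stubs; `sorry` occurs only inside `stub_regularToProjBraid`, `stub_projBraidToDihedral`,
`stub_dihedralNormalForm`, `stub_hoffmanSpanInKZ`, `stub_hoffmanIndependence`. [folklore] -/
theorem UnimodularKernel_of : UnimodularKernel :=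
  unimodularKernel_iff.mpr
    (unimodularKernel_of_stubs stub_regularToProjBraid stub_projBraidToDihedral
      stub_dihedralNormalForm stub_hoffmanSpanInKZ stub_hoffmanIndependence)

end Summit.KontsevichZagierPeriods.KontsevichZagierPeriods.Cruxes.UnimodularKernel.GraphicCore

end
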